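import Literature.AnabelianGeometry.EtaleTheta.FrobenioidThetaOfRootData
import Literature.AnabelianGeometry.EtaleTheta.ThetaFrobenioidOfTempered
import Literature.AnabelianGeometry.EtaleTheta.FrobenioidThetaBiKummerOfModel
import Literature.AnabelianGeometry.EtaleTheta.BiKummerOfModel
import Literature.AlgebraicGeometry.Frobenioids.ModelFrobenioidTypeBridge
import Literature.AlgebraicGeometry.Frobenioids.ModelFrobenioidOrder
import Literature.AnabelianGeometry.EtaleTheta.Discharge.Sec5ModelCase

/-!
# [EtTh] §5 merge row W3-L2-01: the §5 data ASSEMBLED from the §3/§4 structures (pp. 322–324, 330–331 / PDF pp. 96–98, 104–105)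

Mochizuki, *The étale theta function …*, Publ. RIMS **45** (2009)
[cite: MochizukiEtTh2009, §5 p.322–331 (PDF pp.96–105)].  Seat abc-iut-L2-t4 (§5 owner), merge row W3-L2-01 «§5 GENUINE
DATA» (plan/L2/ASSIGNMENTS.md §J; HOME/staging/L2/L2-t4/MERGE-PLAN.md §2/§2a).  ADDITIVE: a CONSTRUCTOR for the §5 data
`ThetaFrobenioid` (FrobenioidTheta.lean, FROZEN) over the landed §3/§4 structures, plus theorems about its values; no landed
file is edited.

§5 opens (p.322 (PDF p.96)): "we return to the situation of Example 3.9 … the divisor monoid `Φ` … determines a tempered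
Frobenioid `C` of monoid type `ℤ` over the base category `D`.  We would like to apply the theory of §4 in the present
situation.  Thus … we take the object `A_⊙` of the theory of §4 to be the [Frobenius-trivial] object defined by the trivial
line bundle over `Ÿ^log`"; and (p.330 (PDF p.104)) "`s^⊓_N, s^⊔_N : A_N → B_N` … constitute an `N`-th root of a right
fraction-pair of an `l`-th root of the theta function `Θ̈` — cf. Proposition 5.2, (i)".  Until now the §5 data
`ThetaFrobenioid C D` were a free hypothesis structure.  Here they are BUILT (`ThetaFrobenioid.ofBiKummerData`) from:
* abc-iut-L2-t3's §4 setting `S : BiKummerSetting X T₀ D VD` (Def. 4.1; `C := S.C`, the model category of the tempered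
  Frobenioid `S.tf`, Def. 3.6 (ii)) — its Frobenioid-level §5 vocabulary is abc-iut-L2-t9's `TemperedFrobenioid.thetaStub`
  with "of base-Frobenius type" := `S.IsOfBaseFrobeniusType` (Def. 4.1 (iv)) (MERGE-PLAN row 1, pinned here);
* `A_⊚ := S.Aodot` ("we take the object `A_⊙` of the theory of §4 to be …", p.322 (PDF p.96));
* `Θ̈ := θ ∈ O^×(A_⊚^birat)`, an `l`-th root datum `Rl` of a right fraction-pair of `Θ̈` (Prop. 4.2 (iii) at level `l`;
  Rmk. 4.3.2) and an `N`-th root datum `R` of the root's fraction-pair (abc-iut-L2-t3's `NthRoot`): `A_N, B_N, s^⊓_N,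
  s^⊔_N := R.AN, R.BN, R.pair.num, R.pair.den` — so the second alternative of Prop. 5.2 (i) HOLDS BY CONSTRUCTION
  (`thetaPairIsNthRoot_ofBiKummerData`);
* the Galois action `ρ : Π^tp_X ↠ Aut_D(B_N^bs)` := the setting's `Π^tp_X ↠ Aut_D(A_N^bs)` (`S.galoisSurj`, at the Galois
  object `A_N^bs`, Def. 4.1 (iv)(a)) transported along `(s^⊓_N)^bs : A_N^bs ⥲ B_N^bs` — a representative of "the natural
  [surjective] outer homomorphism `Π^tp_X ↠ Aut_D(B_N^bs)`" (p.331 (PDF p.105)); the tempered groups are those of a §2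
  `ThetaEnvData T` identified with the setting's `Π^tp_X` by `ιX` (MERGE-PLAN §2a Π-block, `ofThetaEnvData`);
* `s^trv_N := σ` (a section `Aut_D(A_N^bs) → Aut_C(A_N)` arising from a base-Frobenius pair of `A_N`, [FrdI] Prop. 5.6),
  and `s^⊓-gp_N, s^⊔-gp_N` := the UNIQUE lifts of p.331 (`Discharge/Sec5BiKummerSections.liftAlong`, via `ofRootData`) —
  their existence inputs being [FrdI] Thm. 5.2 (ii) (`ModelFrobenioid.Hypotheses`: totally epimorphic, isotropic, Def. 1.3
  (iii)(d) — abc-iut-L1, PROVED for the model) and the divisor-invariance clauses `hdivc`/`hdivp` (p.330 (PDF p.104)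
  "`Div(s^⊓_N)` descends … to `Φ(A_⊚)`"; Prop. 4.3 (i) proof p.317 (PDF p.91));
* the constants `K^× ↪ O^×(B_N^birat)` and the subquotient stub `(l·Δ_Θ)_{(−)}` as given (MERGE-PLAN rows 2, 11).
For data so built: `SgpCapSpec`, `SgpCupSpec`, `StrvSection`, `SgpCapSection`, `AutAmpleBN` are THEOREMS (inherited from
`ofRootData`), Prop. 5.2 (i)'s root clause holds by construction, and the bundle `Facts` of §5 named inputs follows from
`BiKummerDifferenceMem` (Prop. 4.3 (iii) — discharged for these data in the proof-only sequel
`Discharge/Sec5OfBiKummerDataKummer.lean`) and `ConstantsActByCyclotome` (Lemma 5.8, arithmetic step) alone.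
NOT done here (honest): the §1 sections `s_{l·N}`/`τ_{l·N}` themselves are not mapped in — the root data `Rl`, `R` are the
Frobenioid-theoretic incarnation print works with from Prop. 5.2 on ("the pair of morphisms of `C` determined by `s_{l·N}`,
`τ_{l·N}`", p.324 (PDF p.98)); nothing asserts such data exist for an actual curve; typed ≠ proved; no side taken downstream.
-/

noncomputable section

namespace Literature.AnabelianGeometry.EtaleTheta

open CategoryTheory Opposite Literature.AlgebraicGeometry.Frobenioids

universe u₀ v₀ u v w

variable {K : Type u₀} [Field K]

namespace BiKummerSetting

variable {X : SemiGraphs.TemperedArithmeticGroup.{u₀} K} {D₀ : Type u₀} [Category.{v₀} D₀]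
  {V : FrdIMonoidStub.{w}} {T₀ : RealifiedDivisorMonoids (D₀ := D₀) V} {D : Type u} [Category.{v} D]
  {VD : FrdICatStub.{u, v, w} D} (S : BiKummerSetting X T₀ D VD)

/-- `Φ` is objectwise integral for the model data of [FrdI] Thm. 5.2 (`Φ` divisorial ⇒ integral, [FrdI] §0).
[cite: MochizukiFrdI2008, Thm. 5.2 p.100] -/
theorem isIntegral_of_hypotheses (h : ModelFrobenioid.Hypotheses S.tf.divisorMonoid S.tf.ratFnFunctor)
    (A : Dᵒᵖ) : IsIntegral (S.tf.Φ.carrier A) :=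
  (h.isDivisorial A.unop).isPreDivisorial.isIntegral

/-- **The Frobenioid-level §5 vocabulary of the §4 setting** (§5 p.322 (PDF p.96): "a tempered Frobenioid `C` of monoid
type `ℤ` over the base category `D`"; MERGE-PLAN row 1): abc-iut-L2-t9's `TemperedFrobenioid.thetaStub` of the setting's
tempered Frobenioid `S.tf`, with "morphisms of base-Frobenius type" PINNED to Def. 4.1 (iv) (`S.IsOfBaseFrobeniusType`).
[cite: MochizukiEtTh2009, §5 p.322 (PDF p.96); Def 4.1 (iv) p.313 (PDF p.87)] -/
def sec5Stub (h : ModelFrobenioid.Hypotheses S.tf.divisorMonoid S.tf.ratFnFunctor) :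
    FrobenioidTheta.TemperedFrobenioidStub.{w} S.C D :=
  S.tf.thetaStub (S.isIntegral_of_hypotheses h) fun _ _ α => S.IsOfBaseFrobeniusType α

/-- The operations of `sec5Stub` are the model's `(Base, Div, deg_Fr)` ([FrdI] Thm. 5.2 (i)).
[cite: MochizukiFrdI2008, Thm. 5.2 (i) p.100] -/
theorem sec5Stub_pre (h : ModelFrobenioid.Hypotheses S.tf.divisorMonoid S.tf.ratFnFunctor) :
    (S.sec5Stub h).pre = PreFrobenioidData.ofModel S.tf.divisorMonoid S.tf.ratFnFunctor S.tf.divBNatTrans := rfl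

/-- `(s^⊓_N)^bs : A_N^bs ⥲ B_N^bs`, the base-isomorphism of the pre-step `s^⊓_N = s'_N` of an `N`-th root (Prop. 4.2 (iii),
p.314 (PDF p.88): "`s'_N, s''_N : A_N → B_N` are base-equivalent pre-steps").  [cite: MochizukiEtTh2009, Prop 4.2 (iii) p.314 (PDF p.88)] -/
def NthRoot.baseIso {A B : S.C} {f : S.biratUnits A} {P : S.FractionPair f B} {N : ℕ+}
    {pullFrac : ∀ {A A' : S.C} (_ : A' ⟶ A), S.biratUnits A → S.biratUnits A'} (R : S.NthRoot f P N pullFrac) :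
    R.AN.base ≅ R.BN.base :=
  haveI : IsIso (ModelFrobenioid.baseMap R.pair.num) := R.pair.isPreStep_num.2
  asIso (ModelFrobenioid.baseMap R.pair.num)

/-- `(NthRoot.baseIso R).hom = Base(s'_N)`. [cite: MochizukiEtTh2009, Prop 4.2 (iii) p.314 (PDF p.88)] -/
@[simp] theorem NthRoot.baseIso_hom {A B : S.C} {f : S.biratUnits A} {P : S.FractionPair f B} {N : ℕ+}
    {pullFrac : ∀ {A A' : S.C} (_ : A' ⟶ A), S.biratUnits A → S.biratUnits A'} (R : S.NthRoot f P N pullFrac) :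
    (NthRoot.baseIso S R).hom = ModelFrobenioid.baseMap R.pair.num := rfl

end BiKummerSetting

namespace ThetaFrobenioid

variable {X : SemiGraphs.TemperedArithmeticGroup.{u₀} K} {D₀ : Type u₀} [Category.{v₀} D₀]
  {V : FrdIMonoidStub.{w}} {T₀ : RealifiedDivisorMonoids (D₀ := D₀) V} {D : Type u} [Category.{v} D]
  {VD : FrdICatStub.{u, v, w} D} {S : BiKummerSetting X T₀ D VD}
  {pullFrac : ∀ {A A' : S.C} (_ : A' ⟶ A), S.biratUnits A → S.biratUnits A'}
  {lv N : ℕ+} {T : ThetaEnvData.{max v w} N} {θ : S.biratUnits S.Aodot} {Bl : S.C}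
  {Pl : S.FractionPair θ Bl} {Rl : S.NthRoot θ Pl lv pullFrac}

section Rho

variable (R : S.NthRoot Rl.root Rl.pair N pullFrac) (ιX : T.PiX ≃ₜ* X.Pi)

/-- **The Galois action on `B_N^bs`** ("the natural [surjective] outer homomorphism `Π^tp_X ↠ Aut_D(B_N^bs)` [cf.
Definition 4.1, (ii)]", p.331 (PDF p.105)), as the representative obtained from the setting's `Π^tp_X ↠ Aut_D(A_N^bs)` at the
Galois object `A_N^bs` (Def. 4.1 (iv)(a): the `N`-domain of a root is Galois) by transport along `(s^⊓_N)^bs : A_N^bs ⥲ B_N^bs`,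
precomposed with the identification `ιX` of the tempered group of the §2 data with `Π^tp_X`.
[cite: MochizukiEtTh2009, §5 p.331 (PDF p.105); Def 4.1 (ii) p.313 (PDF p.87)] -/
def rhoOfBiKummerData : T.PiX →* Aut R.BN.base :=
  (BiKummerSetting.NthRoot.baseIso S R).conjAut.toMonoidHom.comp
    ((S.galoisSurj R.AN.base R.αData.isGalois).comp ιX.toMulEquiv.toMonoidHom)

/-- `ρ(y) = (s^⊓_N)^bs ∘ ρ_{A_N}(ιX y) ∘ ((s^⊓_N)^bs)⁻¹`. [cite: MochizukiEtTh2009, §5 p.331 (PDF p.105)] -/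
theorem rhoOfBiKummerData_apply (y : T.PiX) :
    rhoOfBiKummerData R ιX y =
      (BiKummerSetting.NthRoot.baseIso S R).conjAut (S.galoisSurj R.AN.base R.αData.isGalois (ιX y)) := rfl

/-- `Π^tp_X ↠ Aut_D(B_N^bs)` is surjective (Def. 4.1 (ii), p.313 (PDF p.87): "natural surjective outer homomorphism").
[cite: MochizukiEtTh2009, Def 4.1 (ii) p.313 (PDF p.87)] -/
theorem rhoOfBiKummerData_surjective : Function.Surjective (rhoOfBiKummerData R ιX) :=
  (BiKummerSetting.NthRoot.baseIso S R).conjAut.surjective.comp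
    ((S.galoisSurj_surjective R.AN.base R.αData.isGalois).comp ιX.toMulEquiv.surjective)

/-- `Ker(Π^tp_X ↠ Aut_D(B_N^bs))` is open (the Galois object `B_N^bs ≅ A_N^bs` corresponds to an open subgroup of the
temperoid; input `hopen` for `A_N^bs`).  [cite: MochizukiEtTh2009, §4 p.312 (PDF p.86)] -/
theorem isOpen_ker_rhoOfBiKummerData (hopen : IsOpen ((S.galoisSurj R.AN.base R.αData.isGalois).ker : Set X.Pi)) :
    IsOpen ((rhoOfBiKummerData R ιX).ker : Set T.PiX) := by
  have hker : ((rhoOfBiKummerData R ιX).ker : Set T.PiX) =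
      ιX ⁻¹' ((S.galoisSurj R.AN.base R.αData.isGalois).ker : Set X.Pi) := by
    ext y
    rw [SetLike.mem_coe, MonoidHom.mem_ker, Set.mem_preimage, SetLike.mem_coe, MonoidHom.mem_ker,
      rhoOfBiKummerData_apply, MulEquiv.map_eq_one_iff]
  rw [hker]
  exact hopen.preimage ιX.continuous

end Rho

variable (h : ModelFrobenioid.Hypotheses S.tf.divisorMonoid S.tf.ratFnFunctor)
  (toB : ∀ A : S.C, S.biratUnits A →* S.tf.biratUnitsModel A) (Q : FrobenioidTheta.ThetaSubquotientStub.{w} D)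
  (odd_l : Odd (lv : ℕ)) (R : S.NthRoot Rl.root Rl.pair N pullFrac) (ιX : T.PiX ≃ₜ* X.Pi)
  (hopen : IsOpen ((S.galoisSurj R.AN.base R.αData.isGalois).ker : Set X.Pi)) (σ : Aut R.AN.base →* Aut R.AN)
  (K' : Type w) [Field K'] (constEmb : K'ˣ →* S.tf.biratUnitsModel R.BN)
  (constEmb_injective : Function.Injective constEmb)
  (hdivc : ∀ g : Aut R.BN.base,
    ModelFrobenioid.div ((σ ((BiKummerSetting.NthRoot.baseIso S R).conjAut.symm g)).hom ≫ R.pair.num) =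
      ModelFrobenioid.div R.pair.num)
  (hdivp : ∀ y : T.PiYdd,
    ModelFrobenioid.div ((σ (S.galoisSurj R.AN.base R.αData.isGalois (ιX y.1))).hom ≫ R.pair.den) =
      ModelFrobenioid.div R.pair.den)

/-- [FrdI] Def. 1.3 (iii)(d) (coslice, full) for the operations of the setting's tempered Frobenioid — abc-iut-L1's
`ModelFrobenioid.iii_d_under_full` ([FrdI] Thm. 5.2 (ii)) read through abc-iut-L1-t3's dictionary `ofFunctor_isCoAngular` /
`ofFunctor_isPreStep` (as in abc-iut-L2-d4's `Discharge/Sec5ModelCase.iiid_of_model`).  [cite: MochizukiFrdI2008, Thm. 5.2(ii) p.101] -/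
theorem iiid_sec5Stub :
    ∀ ⦃A B B' : S.C⦄ (φ : A ⟶ B) (φ' : A ⟶ B'), (S.sec5Stub h).pre.IsCoAngularPreStep φ →
      (S.sec5Stub h).pre.IsCoAngularPreStep φ' → (S.sec5Stub h).pre.div φ ∣ (S.sec5Stub h).pre.div φ' →
        ∃ f : B ⟶ B', (S.sec5Stub h).pre.IsCoAngularPreStep f ∧ φ ≫ f = φ' := by
  intro A B B' φ φ' hφ hφ' hd
  have hc : PreFrobenioid.IsCoAngularPreStep S.tf.toElem φ :=
    ⟨(PreFrobenioidData.ofFunctor_isCoAngular _ φ).mp hφ.1, (PreFrobenioidData.ofFunctor_isPreStep _ φ).mp hφ.2⟩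
  have hc' : PreFrobenioid.IsCoAngularPreStep S.tf.toElem φ' :=
    ⟨(PreFrobenioidData.ofFunctor_isCoAngular _ φ').mp hφ'.1, (PreFrobenioidData.ofFunctor_isPreStep _ φ').mp hφ'.2⟩
  obtain ⟨f, hf, hcomp⟩ := ModelFrobenioid.iii_d_under_full h.isGroupLike_rat φ φ' hc hc' hd
  exact ⟨f, ⟨(PreFrobenioidData.ofFunctor_isCoAngular _ f).mpr hf.1,
    (PreFrobenioidData.ofFunctor_isPreStep _ f).mpr hf.2⟩, hcomp⟩

/-- **[EtTh] §5 data assembled from the §3/§4 structures** (W3-L2-01 «§5 GENUINE DATA», MERGE-PLAN §2a): the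
`ThetaFrobenioid S.C D` with `C :=` the setting's tempered Frobenioid (`sec5Stub`), `A_⊚ := S.Aodot` (p.322 (PDF p.96)),
`(A_N, B_N, s^⊓_N, s^⊔_N) :=` the `N`-th root `R` of the fraction-pair of the `l`-th root `Rl.root` of `Θ̈ = θ` (p.330
(PDF p.104); Prop. 5.2 (i)), tempered groups := those of the §2 data `T` (`ofThetaEnvData`), `ρ := rhoOfBiKummerData`,
`s^trv_N := σ`, `s^⊓-gp_N, s^⊔-gp_N :=` the unique lifts of p.331 (`ofRootData`; existence inputs: [FrdI] Thm. 5.2 (ii) via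
`ModelFrobenioid.Hypotheses`, and the divisor-invariance clauses `hdivc`, `hdivp`), constants and `(l·Δ_Θ)_{(−)}` as given,
`Θ̈ := toB θ` read in `O^×(A_⊚^birat) = B(A_⊚^bs)^×` through the [FrdI] Thm. 5.2 (ii) dictionary `toB` (the identity for
abc-iut-L2-t9's `BiKummerSetting.mkOfModel`).  [cite: MochizukiEtTh2009, §5 p.322–331 (PDF pp.96–105)] -/
def ofBiKummerData : ThetaFrobenioid.{w} S.C D :=
  ofRootData (S.sec5Stub h) Q lv odd_l N T S.Aodot R.AN R.BN R.pair.num R.pair.den R.pair.base_eq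
    ⟨R.pair.isPreStep_num.1, R.pair.isPreStep_num.2⟩ ⟨R.pair.isPreStep_den.1, R.pair.isPreStep_den.2⟩
    (rhoOfBiKummerData R ιX) (rhoOfBiKummerData_surjective R ιX) (isOpen_ker_rhoOfBiKummerData R ιX hopen) σ K'
    constEmb constEmb_injective (toB S.Aodot θ) (epi_of_model (DivB := S.tf.divBNatTrans) h)
    (ModelFrobenioid.ofModel_isOfIsotropicType S.tf.divisorMonoid S.tf.ratFnFunctor S.tf.divBNatTrans h.isGroupLike_rat)
    (iiid_sec5Stub h) (fun g => hdivc g)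
    (by
      rintro ⟨_, y, hy, rfl⟩
      change (S.sec5Stub h).pre.div ((σ ((BiKummerSetting.NthRoot.baseIso S R).conjAut.symm
        ((BiKummerSetting.NthRoot.baseIso S R).conjAut (S.galoisSurj R.AN.base R.αData.isGalois (ιX y))))).hom ≫
          R.pair.den) = _
      rw [MulEquiv.symm_apply_apply]
      exact hdivp ⟨y, hy⟩)

/-! ### Dictionary: the fields of `ofBiKummerData` are the §3/§4 data (all `rfl`) -/

section Dictionary

/-- The operations of the data are the model's `(Base, Div, deg_Fr)` ([FrdI] Thm. 5.2 (i)) — so every "model case" discharge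
of §5 (abc-iut-L2-d4's `Discharge/Sec5ModelCase.lean`, hypothesis `h𝔉 : 𝔉.pre = PreFrobenioidData.ofModel …`) applies with
`h𝔉 := rfl`.  [cite: MochizukiFrdI2008, Thm. 5.2 (i) p.100] -/
theorem ofBiKummerData_pre :
    (ofBiKummerData h toB Q odd_l R ιX hopen σ K' constEmb constEmb_injective hdivc hdivp).pre =
      PreFrobenioidData.ofModel S.tf.divisorMonoid S.tf.ratFnFunctor S.tf.divBNatTrans := rfl

/-- The Frobenioid-level part IS abc-iut-L2-t9's `thetaStub` of the setting's tempered Frobenioid (MERGE-PLAN row 1; so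
`TemperedFrobenioid.thetaVocab` / `applicability_of_model` — Prop. 5.1 for the model — apply with `h𝔉 := rfl`).
[cite: MochizukiEtTh2009, Prop 5.1 p.323 (PDF p.97)] -/
theorem ofBiKummerData_stub :
    (ofBiKummerData h toB Q odd_l R ιX hopen σ K' constEmb constEmb_injective hdivc hdivp).toTemperedFrobenioidStub =
      S.tf.thetaStub (S.isIntegral_of_hypotheses h) (fun _ _ α => S.IsOfBaseFrobeniusType α) := rfl

/-- `A_⊚ = A_⊙` ("we take the object `A_⊙` of the theory of §4 to be …", p.322 (PDF p.96)).
[cite: MochizukiEtTh2009, §5 p.322 (PDF p.96)] -/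
theorem ofBiKummerData_Acirc :
    (ofBiKummerData h toB Q odd_l R ιX hopen σ K' constEmb constEmb_injective hdivc hdivp).Acirc = S.Aodot := rfl

/-- `A_N` is the `N`-domain of the root datum `R` (p.330 (PDF p.104)). [cite: MochizukiEtTh2009, §5 p.330 (PDF p.104)] -/
theorem ofBiKummerData_AN :
    (ofBiKummerData h toB Q odd_l R ιX hopen σ K' constEmb constEmb_injective hdivc hdivp).AN = R.AN := rfl

/-- `B_N` is the `N`-codomain of the root datum `R` (p.330 (PDF p.104)). [cite: MochizukiEtTh2009, §5 p.330 (PDF p.104)] -/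
theorem ofBiKummerData_BN :
    (ofBiKummerData h toB Q odd_l R ιX hopen σ K' constEmb constEmb_injective hdivc hdivp).BN = R.BN := rfl

/-- `s^⊓_N = s'_N`, the numerator pre-step of the root's fraction-pair (p.330 (PDF p.104); Def. 4.1 (i)).
[cite: MochizukiEtTh2009, §5 p.330 (PDF p.104)] -/
theorem ofBiKummerData_sCap :
    (ofBiKummerData h toB Q odd_l R ιX hopen σ K' constEmb constEmb_injective hdivc hdivp).sCap = R.pair.num := rfl

/-- `s^⊔_N = s''_N`, the denominator pre-step of the root's fraction-pair (p.330 (PDF p.104); Def. 4.1 (i)).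
[cite: MochizukiEtTh2009, §5 p.330 (PDF p.104)] -/
theorem ofBiKummerData_sCup :
    (ofBiKummerData h toB Q odd_l R ιX hopen σ K' constEmb constEmb_injective hdivc hdivp).sCup = R.pair.den := rfl

/-- `Θ̈` of the data is `θ` read through the dictionary. [cite: MochizukiEtTh2009, §5 p.324 (PDF p.98)] -/
theorem ofBiKummerData_thetaFn :
    (ofBiKummerData h toB Q odd_l R ιX hopen σ K' constEmb constEmb_injective hdivc hdivp).thetaFn = toB S.Aodot θ := rfl

/-- `l` is the level of the `l`-th root datum `Rl`. [cite: MochizukiEtTh2009, §5 p.322 (PDF p.96)] -/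
theorem ofBiKummerData_l :
    (ofBiKummerData h toB Q odd_l R ιX hopen σ K' constEmb constEmb_injective hdivc hdivp).l = lv := rfl

/-- `Π^tp_X̲` of the data IS `T.PiX` (Π-block from the §2 data). [cite: MochizukiEtTh2009, §5 p.330 (PDF p.104)] -/
theorem ofBiKummerData_PiX :
    (ofBiKummerData h toB Q odd_l R ιX hopen σ K' constEmb constEmb_injective hdivc hdivp).PiX = T.PiX := rfl

/-- `Π^tp_Ÿ̲` of the data IS `T.PiYdd`. [cite: MochizukiEtTh2009, §5 p.332 (PDF p.106)] -/
theorem ofBiKummerData_PiYdd :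
    (ofBiKummerData h toB Q odd_l R ιX hopen σ K' constEmb constEmb_injective hdivc hdivp).PiYdd = T.PiYdd := rfl

/-- `ρ` of the data is `rhoOfBiKummerData`. [cite: MochizukiEtTh2009, §5 p.331 (PDF p.105)] -/
theorem ofBiKummerData_ρ :
    (ofBiKummerData h toB Q odd_l R ιX hopen σ K' constEmb constEmb_injective hdivc hdivp).ρ = rhoOfBiKummerData R ιX :=
  rfl

/-- `s^trv_N` of the data is `σ`. [cite: MochizukiEtTh2009, §5 p.330–331 (PDF pp.104–105)] -/
theorem ofBiKummerData_strv :
    (ofBiKummerData h toB Q odd_l R ιX hopen σ K' constEmb constEmb_injective hdivc hdivp).strv = σ := rfl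

/-- `Aut_D(A_N^bs) ⥲ Aut_D(B_N^bs)` of the data ("determined by the [base-equivalent!] pair", p.331 (PDF p.105)) is conjugation by
`(s'_N)^bs`.  [cite: MochizukiEtTh2009, §5 p.331 (PDF p.105)] -/
theorem ofBiKummerData_autBaseIsoAB :
    (ofBiKummerData h toB Q odd_l R ιX hopen σ K' constEmb constEmb_injective hdivc hdivp).autBaseIsoAB =
      (BiKummerSetting.NthRoot.baseIso S R).conjAut := rfl

/-- `H_{B_N}` of the data is the `ρ`-image of `Π^tp_Ÿ` (p.331 (PDF p.105); Def. 4.1 (ii)). [cite: MochizukiEtTh2009, §5 p.331 (PDF p.105)] -/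
theorem ofBiKummerData_HB :
    (ofBiKummerData h toB Q odd_l R ιX hopen σ K' constEmb constEmb_injective hdivc hdivp).HB =
      T.PiYdd.map (rhoOfBiKummerData R ιX) := rfl

/-- On `Aut_D(A_N^bs)` the pull-back `(Aut_D(A_N^bs) ⥲ Aut_D(B_N^bs))⁻¹ ∘ ρ` is the setting's own Galois action on `A_N^bs`:
`((s'_N)^bs)⁻¹ ρ(y) (s'_N)^bs = ρ_{A_N}(ιX y)`.  [cite: MochizukiEtTh2009, §5 p.331 (PDF p.105)] -/
theorem ofBiKummerData_autBaseIsoAB_symm_ρ (y : T.PiX) :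
    (ofBiKummerData h toB Q odd_l R ιX hopen σ K' constEmb constEmb_injective hdivc hdivp).autBaseIsoAB.symm
        ((ofBiKummerData h toB Q odd_l R ιX hopen σ K' constEmb constEmb_injective hdivc hdivp).ρ y) =
      S.galoisSurj R.AN.base R.αData.isGalois (ιX y) := by
  change (BiKummerSetting.NthRoot.baseIso S R).conjAut.symm
    ((BiKummerSetting.NthRoot.baseIso S R).conjAut (S.galoisSurj R.AN.base R.αData.isGalois (ιX y))) = _
  exact MulEquiv.symm_apply_apply _ _

end Dictionary

/-! ### The §5 named inputs are THEOREMS for `ofBiKummerData` -/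

section Facts

/-- **`SgpCapSpec`** (defining relation of `s^⊓-gp_N`, p.331 (PDF p.105)) HOLDS. [cite: MochizukiEtTh2009, §5 p.331 (PDF p.105)] -/
theorem sgpCapSpec_ofBiKummerData :
    (ofBiKummerData h toB Q odd_l R ιX hopen σ K' constEmb constEmb_injective hdivc hdivp).SgpCapSpec := by
  delta ofBiKummerData
  apply sgpCapSpec_ofRootData

/-- **`SgpCupSpec`** (defining relation of `s^⊔-gp_N`, p.331 (PDF p.105)) HOLDS. [cite: MochizukiEtTh2009, §5 p.331 (PDF p.105)] -/
theorem sgpCupSpec_ofBiKummerData :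
    (ofBiKummerData h toB Q odd_l R ιX hopen σ K' constEmb constEmb_injective hdivc hdivp).SgpCupSpec := by
  delta ofBiKummerData
  apply sgpCupSpec_ofRootData

/-- **`StrvSection`** from the section property of `σ` ([FrdI] Prop. 5.6; input `hσ`).
[cite: MochizukiEtTh2009, §5 p.330–331 (PDF pp.104–105)] -/
theorem strvSection_ofBiKummerData (hσ : ∀ g : Aut R.AN.base, ModelFrobenioid.baseMap (σ g).hom = g.hom) :
    (ofBiKummerData h toB Q odd_l R ιX hopen σ K' constEmb constEmb_injective hdivc hdivp).StrvSection :=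
  fun g => Aut.ext (hσ g)

/-- **`SgpCapSection`** (`(s^⊓-gp_N(g))^bs = g`). [cite: MochizukiEtTh2009, §5 p.331 (PDF p.105)] -/
theorem sgpCapSection_ofBiKummerData (hσ : ∀ g : Aut R.AN.base, ModelFrobenioid.baseMap (σ g).hom = g.hom) :
    (ofBiKummerData h toB Q odd_l R ιX hopen σ K' constEmb constEmb_injective hdivc hdivp).SgpCapSection :=
  sgpCapSection_of _ (sgpCapSpec_ofBiKummerData h toB Q odd_l R ιX hopen σ K' constEmb constEmb_injective hdivc hdivp)
    (strvSection_ofBiKummerData h toB Q odd_l R ιX hopen σ K' constEmb constEmb_injective hdivc hdivp hσ)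

/-- **"`B_N` is Aut-ample"** (p.330 (PDF p.104)). [cite: MochizukiEtTh2009, §5 p.330 (PDF p.104)] -/
theorem autAmpleBN_ofBiKummerData (hσ : ∀ g : Aut R.AN.base, ModelFrobenioid.baseMap (σ g).hom = g.hom) :
    (ofBiKummerData h toB Q odd_l R ιX hopen σ K' constEmb constEmb_injective hdivc hdivp).AutAmpleBN :=
  autAmpleBN_of_sgpCapSection _ (sgpCapSection_ofBiKummerData h toB Q odd_l R ιX hopen σ K' constEmb
    constEmb_injective hdivc hdivp hσ)

/-- **The bundle `Facts` of §5 named inputs** for the assembled data from: the section property of `σ` ([FrdI] Prop. 5.6),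
`BiKummerDifferenceMem` (Prop. 4.3 (iii) — see `Discharge/Sec5OfBiKummerDataKummer.lean` for its discharge) and
`ConstantsActByCyclotome` (Lemma 5.8, arithmetic step).  [cite: MochizukiEtTh2009, §5 p.330–331 (PDF pp.104–105)] -/
theorem facts_ofBiKummerData (hσ : ∀ g : Aut R.AN.base, ModelFrobenioid.baseMap (σ g).hom = g.hom)
    (hdiff : (ofBiKummerData h toB Q odd_l R ιX hopen σ K' constEmb constEmb_injective hdivc hdivp).BiKummerDifferenceMem)
    (hK : (ofBiKummerData h toB Q odd_l R ιX hopen σ K' constEmb constEmb_injective hdivc hdivp).ConstantsActByCyclotome) :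
    (ofBiKummerData h toB Q odd_l R ιX hopen σ K' constEmb constEmb_injective hdivc hdivp).Facts :=
  Facts.of_totallyEpi _ (epi_of_model (DivB := S.tf.divBNatTrans) h)
    (sgpCapSpec_ofBiKummerData h toB Q odd_l R ιX hopen σ K' constEmb constEmb_injective hdivc hdivp)
    (sgpCupSpec_ofBiKummerData h toB Q odd_l R ιX hopen σ K' constEmb constEmb_injective hdivc hdivp)
    (strvSection_ofBiKummerData h toB Q odd_l R ιX hopen σ K' constEmb constEmb_injective hdivc hdivp hσ) hdiff hK

end Facts

/-! ### Proposition 5.2 (i) holds by construction -/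

section Prop52i

/-- **[EtTh] Prop. 5.2 (i), second alternative, BY CONSTRUCTION**: `(s^⊓_N, s^⊔_N)` "constitutes … an `N`-th root of a right
fraction-pair … of an `l`-th root of the theta function `Θ̈`" (p.324 (PDF p.98)) — for the assembled data the pair IS the root
pair of the `N`-th root datum `R` of the fraction-pair of `Rl.root`, an `l`-th root of `θ = Θ̈`.
[cite: MochizukiEtTh2009, Prop 5.2 (i) p.324 (PDF p.98)] -/
theorem pairIsNthRoot_ofBiKummerData :
    S.PairIsNthRootOf pullFrac N Rl.root
      (ofBiKummerData h toB Q odd_l R ιX hopen σ K' constEmb constEmb_injective hdivc hdivp).sCap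
      (ofBiKummerData h toB Q odd_l R ιX hopen σ K' constEmb constEmb_injective hdivc hdivp).sCup :=
  S.pairIsNthRootOf_nthRoot pullFrac R

/-- `Rl.root` is an `l`-th root of `θ = Θ̈` in the sense of Rmk. 4.3.2 (the root element of the `l`-th root datum `Rl`), provided
pull-back of birational units along the identity is the identity (`hpull_id`; true for the model's `pullFracModel`).
[cite: MochizukiEtTh2009, Rmk 4.3.2 p.318 (PDF p.92)] -/
theorem isNthRoot_lthRoot (hpull_id : ∀ (A : S.C) (x : S.biratUnits A), pullFrac (𝟙 A) x = x) :
    S.IsNthRootOf pullFrac lv Rl.root θ :=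
  ⟨lv.pos, Bl, Pl, Rl, Iso.refl _, hpull_id _ _⟩

/-- **[EtTh] Prop. 5.2 (i) for the assembled data at the real vocabulary** (`BiKummerVocabStub.ofBiKummerSetting`, with the
dictionary `toB` bijective — the identity for `mkOfModel`): the second alternative holds BY CONSTRUCTION (`R` over `Rl`); the
first ("an `l·N`-th root of a right fraction-pair of `Θ̈`") is the composite reading of Rmk. 4.3.2 (an `N`-th root of an `l`-th
root is an `l·N`-th root), entering as the binder `hcomp` (not derivable over the abstract `BaseFrobeniusTypeData` /
saturation fields of abc-iut-L2-t3's `NthRoot`).  [cite: MochizukiEtTh2009, Prop 5.2 (i) p.324 (PDF p.98); Rmk 4.3.2 p.318–319 (PDF pp.92–93)] -/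
theorem thetaPairIsRoot_ofBiKummerData (hbij : ∀ A : S.C, Function.Bijective (toB A))
    (hpull_id : ∀ (A : S.C) (x : S.biratUnits A), pullFrac (𝟙 A) x = x)
    (hcomp : S.PairIsNthRootOf pullFrac ((lv : ℕ) * N) θ R.pair.num R.pair.den) :
    FrobenioidThetaBiKummer.ThetaPairIsRoot
      (ofBiKummerData h toB Q odd_l R ιX hopen σ K' constEmb constEmb_injective hdivc hdivp)
      (FrobenioidThetaBiKummer.BiKummerVocabStub.ofBiKummerSetting S pullFrac _
        fun A => (MulEquiv.ofBijective (toB A) (hbij A)).symm) := by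
  have hθ : (MulEquiv.ofBijective (toB S.Aodot) (hbij S.Aodot)).symm (toB S.Aodot θ) = θ :=
    (MulEquiv.ofBijective (toB S.Aodot) (hbij S.Aodot)).symm_apply_apply θ
  have hg : (MulEquiv.ofBijective (toB Rl.AN) (hbij Rl.AN)).symm (toB Rl.AN Rl.root) = Rl.root :=
    (MulEquiv.ofBijective (toB Rl.AN) (hbij Rl.AN)).symm_apply_apply Rl.root
  change S.PairIsNthRootOf pullFrac ((lv : ℕ) * (N : ℕ))
      ((MulEquiv.ofBijective (toB S.Aodot) (hbij S.Aodot)).symm (toB S.Aodot θ)) R.pair.num R.pair.den ∧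
    ∃ (A' : S.C) (g : S.tf.biratUnitsModel A'),
      S.IsNthRootOf pullFrac lv ((MulEquiv.ofBijective (toB A') (hbij A')).symm g)
        ((MulEquiv.ofBijective (toB S.Aodot) (hbij S.Aodot)).symm (toB S.Aodot θ)) ∧
      S.PairIsNthRootOf pullFrac N ((MulEquiv.ofBijective (toB A') (hbij A')).symm g) R.pair.num R.pair.den
  rw [hθ]
  refine ⟨hcomp, Rl.AN, toB Rl.AN Rl.root, ?_, ?_⟩
  · rw [hg]
    exact isNthRoot_lthRoot hpull_id
  · rw [hg]
    exact S.pairIsNthRootOf_nthRoot pullFrac R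

end Prop52i

end ThetaFrobenioid

end Literature.AnabelianGeometry.EtaleTheta

end
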